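import Literature.NumberTheory.DiophantineGeometry.FunctionFieldZetaEulerProductProofs
import HarnessLib

/-!
# Rationality of the zeta function: Stichtenoth Thm. 5.1.15 (a) from F. K. Schmidt's theorem `∂ = 1`

Sibling **proof file** (theorems only; D-0014) of `FunctionFieldZeta`, for its named fact
`lSeries_eq_polynomial` — **Stichtenoth Thm. 5.1.15 (a)** (F. K. Schmidt 1931): for an algebraic
function field `F/𝔽_q` of one variable with full constant field `𝔽_q` and (Riemann–Roch) genus `g`,
the `L`-polynomial `L(t) = (1 - t)(1 - qt) Z(t)` lies in `ℤ[t]` and has degree `2g`.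

The printed proof (H. Stichtenoth, *Algebraic Function Fields and Codes*, 2nd ed., §5.1, held copy
`book:stichtenothnd-algebraic-function-fields-codes`, text pp. 160–166) rests on

* Lemma 5.1.4 (b), (c): `A_n (q - 1) = h (q^{n+1-g} - 1)` for `n > 2g - 2`, `∂ ∣ n` — **proved in
  the tree** (`FunctionFieldDivisorClasses.numPosDivisors_mul_eq`, from the Riemann–Roch theorem
  `FunctionFieldAdelesProofs.riemann_roch_holds` and the finiteness of the class number, Prop. 5.1.3);
* **Cor. 5.1.11 (F. K. Schmidt): `∂ = 1`**, proved in the book through the constant field extension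
  `F𝔽_{q^∂}` (Prop. 5.1.10) — **not in the tree**; it enters here as the explicit hypothesis
  `minPosDegree K F = 1` (`minPosDegree = ∂` of `FunctionFieldDivisorClasses`);
* the functional equation (Prop. 5.1.13) for `deg L = 2g`, i.e. `a_{2g} = q^g` (Thm. 5.1.15 (d)).

## What is proved

* `coeff_one_lSeries`, `coeff_add_two_lSeries`: `a₁ = A₁ - (q+1) A₀`,
  `a_{n+2} = A_{n+2} - (q+1) A_{n+1} + q A_n` (eq. (5.12), "comparing coefficients");
* `numEffDivisors_mul_sub_one_eq`: Lemma 5.1.4 (c) with `∂ = 1`, in `ℤ`;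
  `classNumber_eq_one_of_genus_eq_zero`: `g = 0 ⇒ h = 1` (proof of Prop. 5.1.6 (a));
* `coeff_lSeries_eq_zero`: `a_m = 0` for `m > 2g` ("`L(t)` is a polynomial of degree `≤ 2g`");
* `ell_eq_zero_of_degree_eq_zero_of_not_isPrincipal` (Cor. 1.4.12 (c)),
  `numEffDivisors_mul_sub_one_eq_finsum` (`A_n (q-1) = ∑_{[C] ∈ Clⁿ} (q^{ℓ([C])} - 1)`, Lemma 5.1.4 (b)
  summed over classes) and `numEffDivisors_two_mul_genus_sub_two`:
  `A_{2g-2} (q - 1) = (q^g - 1) + (h - 1)(q^{g-1} - 1)` for `g ≥ 1` — the canonical class has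
  `ℓ = g`, the other `h - 1` classes of degree `2g - 2` have `ℓ = g - 1` by Riemann–Roch (this is the
  content of the term `deg [C] = 2g - 2` of `F(t)` in Prop. 5.1.6 (b) / eq. (5.10); it replaces the
  functional equation in the computation of the leading coefficient);
* `coeff_two_mul_genus_lSeries`: `a_{2g} = q^g` (Thm. 5.1.15 (d)(1)), computed directly from the
  three values `A_{2g}`, `A_{2g-1}`, `A_{2g-2}`;
* `lSeries_eq_polynomial_of_minPosDegree_eq_one`: **Thm. 5.1.15 (a) from `∂ = 1`**, with
  `L = trunc_{2g+1} L(t)`.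

So, of the two named facts of `FunctionFieldZeta` feeding `FunctionFieldZetaProofs.isGenus_genus_of_facts`
(and the leaf `hWeil` of the function-field `L(E, s)` continuation,
`FunctionFieldEllipticLContinuationLeavesProofs.hasLContinuation_of_functionField_of_zeta_leaves`),
Thm. 5.1.15 (a) is reduced to F. K. Schmidt's `∂ = 1`; Thm. 5.2.1 (Hasse–Weil) is untouched.

## Design notes

* Theorems only; the hypothesis `∂ = 1` is the plain equation `minPosDegree K F = 1` (a named-fact
  wrapper with the citation Cor. 5.1.11 can feed it verbatim).
* All identities with `q - 1`, `q^e - 1`, `h - 1` are moved to `ℤ` before any algebra (`ℕ`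
  subtraction); `numPosDivisors` of `FunctionFieldDivisorClasses` is `numEffDivisors` by `rfl`.

## References

* H. Stichtenoth, *Algebraic Function Fields and Codes*, 2nd ed., GTM 254, Springer 2009: Cor. 1.4.12,
  §5.1 (Prop. 5.1.3, Lemma 5.1.4, Prop. 5.1.6, Cor. 5.1.11, eq. (5.12), Def. 5.1.14, Thm. 5.1.15).
  [Stichtenoth2009]
* F. K. Schmidt, *Analytische Zahlentheorie in Körpern der Charakteristik p*, Math. Z. 33 (1931)
  (rationality of the zeta function; existence of divisors of degree one). [Schmidt1931]
-/

noncomputable section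

open scoped Classical

namespace Literature.NumberTheory.DiophantineGeometry.AlgFunctionField

universe u v

variable {K : Type u} {F : Type v} [Field K] [Field F] [Algebra K F]

open PowerSeries

/-! ### Coefficients of the `L`-polynomial -/

section Coefficients

variable [Fintype K]

/-- `L(t) = (1 - (q+1) t + q t²) Z(t)`: the coefficient of `t` is `a₁ = A₁ - (q + 1) A₀`
(Stichtenoth eq. (5.12) and the proof of Thm. 5.1.15 (d)). [cite: Stichtenoth2009, eq. (5.12)] -/
theorem coeff_one_lSeries :
    coeff 1 (lSeries K F) =
      numEffDivisors K F 1 - ((Fintype.card K : ℤ) + 1) * numEffDivisors K F 0 := by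
  have h : lSeries K F = (1 - C ((Fintype.card K : ℤ) + 1) * X + C (Fintype.card K : ℤ) * X ^ 2) *
      zeta K F := by
    rw [lSeries]; ring_nf; simp [map_add]; ring
  rw [h, add_mul, sub_mul, one_mul, map_add, map_sub, mul_assoc, coeff_C_mul,
    show (1 : ℕ) = 0 + 1 from rfl, coeff_succ_X_mul, mul_assoc, coeff_C_mul, coeff_X_pow_mul']
  simp [coeff_zeta]

/-- `L(t) = (1 - (q+1) t + q t²) Z(t)`: for `n ≥ 0` the coefficient of `t^{n+2}` is
`A_{n+2} - (q + 1) A_{n+1} + q A_n` (Stichtenoth eq. (5.12): "comparing coefficients").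
[cite: Stichtenoth2009, eq. (5.12)] -/
theorem coeff_add_two_lSeries (n : ℕ) :
    coeff (n + 2) (lSeries K F) =
      numEffDivisors K F (n + 2) - ((Fintype.card K : ℤ) + 1) * numEffDivisors K F (n + 1) +
        (Fintype.card K : ℤ) * numEffDivisors K F n := by
  have h : lSeries K F = (1 - C ((Fintype.card K : ℤ) + 1) * X + C (Fintype.card K : ℤ) * X ^ 2) *
      zeta K F := by
    rw [lSeries]; ring_nf; simp [map_add]; ring
  rw [h, add_mul, sub_mul, one_mul, map_add, map_sub, mul_assoc, coeff_C_mul,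
    show n + 2 = (n + 1) + 1 from rfl, coeff_succ_X_mul, mul_assoc, coeff_C_mul, coeff_X_pow_mul']
  simp [coeff_zeta]

end Coefficients


/-! ### Lemma 5.1.4 (c) with `∂ = 1`; the coefficients beyond `t^{2g}` vanish -/

section LargeDegree

variable [Fintype K] [IsAlgFunctionField K F] [IsIntegrallyClosedIn K F]

/-- **Stichtenoth Lemma 5.1.4 (c) with `∂ = 1`**, in `ℤ`: for `n > 2g - 2`,
`A_n · (q - 1) = h · (q^{n+1-g} - 1)` (`numPosDivisors_mul_eq` of `FunctionFieldDivisorClasses`,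
whose `A_n` is `numEffDivisors` definitionally). [cite: Stichtenoth2009, Lemma 5.1.4(c)] -/
theorem numEffDivisors_mul_sub_one_eq (h1 : minPosDegree K F = 1) {n : ℕ}
    (hn : 2 * genus K F < n + 2) :
    (numEffDivisors K F n : ℤ) * ((Fintype.card K : ℤ) - 1) =
      classNumber K F * ((Fintype.card K : ℤ) ^ (n + 1 - genus K F) - 1) := by
  have h := numPosDivisors_mul_eq (K := K) (F := F) hn (h1 ▸ one_dvd n)
  rw [Nat.card_eq_fintype_card] at h
  have hq : 1 ≤ Fintype.card K := Fintype.card_pos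
  have hq' : 1 ≤ Fintype.card K ^ (n + 1 - genus K F) := Nat.one_le_pow _ _ hq
  have h' := congrArg (fun x : ℕ => (x : ℤ)) h
  push_cast [Nat.cast_sub hq, Nat.cast_sub hq'] at h'
  exact h'

/-- For `g = 0` the class number is `h = 1` (Stichtenoth, proof of Prop. 5.1.6 (a): "a function
field of genus zero has class number `1`"), here read off from Lemma 5.1.4 (c) at `n = 0`:
`A₀ (q - 1) = h (q - 1)` with `A₀ = 1`. [cite: Stichtenoth2009, Prop. 5.1.6(a) (proof)] -/
theorem classNumber_eq_one_of_genus_eq_zero (h1 : minPosDegree K F = 1) (hg : genus K F = 0) :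
    classNumber K F = 1 := by
  have h := numEffDivisors_mul_sub_one_eq (K := K) (F := F) h1 (n := 0) (by omega)
  rw [numEffDivisors_zero, hg, Nat.sub_zero, zero_add, pow_one, Nat.cast_one, one_mul] at h
  have hq : (1 : ℤ) < Fintype.card K := by exact_mod_cast Fintype.one_lt_card
  have : (classNumber K F : ℤ) = 1 := by
    have hne : (Fintype.card K : ℤ) - 1 ≠ 0 := by linarith
    exact (mul_left_cancel₀ hne (by linarith)).symm
  exact_mod_cast this

/-- **The `L`-polynomial has degree `≤ 2g`** (Stichtenoth, after Def. 5.1.14: "By Corollary 5.1.12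
it is obvious that `L(t)` is a polynomial of degree `≤ 2g`"; Thm. 5.1.15 (a)), granted `∂ = 1`:
for `m > 2g` the coefficient `a_m = A_m - (q+1) A_{m-1} + q A_{m-2}` of `(1 - t)(1 - qt) Z(t)`
vanishes, by Lemma 5.1.4 (c) (`A_n = h (q^{n+1-g} - 1)/(q - 1)` for `n ≥ 2g - 1`).
[cite: Stichtenoth2009, Thm. 5.1.15(a)] -/
theorem coeff_lSeries_eq_zero (h1 : minPosDegree K F = 1) {m : ℕ} (hm : 2 * genus K F < m) :
    coeff m (lSeries K F) = 0 := by
  have hq1 : (1 : ℤ) < Fintype.card K := by exact_mod_cast Fintype.one_lt_card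
  have hqne : (Fintype.card K : ℤ) - 1 ≠ 0 := by linarith
  set q : ℤ := (Fintype.card K : ℤ) with hq
  rcases m with _ | _ | n
  · omega
  · -- `m = 1`, so `g = 0` and `h = 1`: `a₁ = A₁ - (q + 1) = 0`
    have hg : genus K F = 0 := by omega
    have hh := classNumber_eq_one_of_genus_eq_zero (K := K) (F := F) h1 hg
    have hA1 := numEffDivisors_mul_sub_one_eq (K := K) (F := F) h1 (n := 1) (by omega)
    rw [hh, hg, Nat.cast_one, one_mul, Nat.sub_zero] at hA1
    apply mul_left_cancel₀ hqne
    rw [coeff_one_lSeries, numEffDivisors_zero, mul_zero, mul_sub, mul_comm _ (numEffDivisors K F 1 : ℤ),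
      hA1]
    push_cast
    ring
  · -- `m = n + 2` with `n ≥ 2g - 1`
    have hA0 := numEffDivisors_mul_sub_one_eq (K := K) (F := F) h1 (n := n) (by omega)
    have hA1 := numEffDivisors_mul_sub_one_eq (K := K) (F := F) h1 (n := n + 1) (by omega)
    have hA2 := numEffDivisors_mul_sub_one_eq (K := K) (F := F) h1 (n := n + 2) (by omega)
    have e1 : n + 1 + 1 - genus K F = (n + 1 - genus K F) + 1 := by omega
    have e2 : n + 2 + 1 - genus K F = (n + 1 - genus K F) + 2 := by omega
    rw [e1, pow_succ] at hA1
    rw [e2, pow_add] at hA2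
    apply mul_left_cancel₀ hqne
    rw [coeff_add_two_lSeries, mul_zero]
    linear_combination hA2 - (q + 1) * hA1 + q * hA0

end LargeDegree


/-! ### The number `A_{2g-2}`: classes of degree `2g - 2` -/

section DegreeZero

variable [IsAlgFunctionField K F]

/-- A positive divisor of degree `0` is `0` (every place has degree `≥ 1`). [folklore] -/
theorem Divisor.eq_zero_of_nonneg_of_degree_eq_zero {A : Divisor K F} (hA : 0 ≤ A)
    (h0 : A.degree = 0) : A = 0 := by
  ext P
  have h1 := Divisor.apply_mul_degree_le_degree hA P
  have h2 : (1 : ℤ) ≤ P.degree := by exact_mod_cast P.one_le_degree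
  have h3 : 0 ≤ A P := by simpa using hA P
  rw [h0] at h1
  change A P = 0
  nlinarith

/-- **Stichtenoth Cor. 1.4.12 (c)** ((2) ⇒ (1), contrapositive): a divisor of degree `0` which is not principal has
`ℓ(D) = 0` — if `0 ≠ x ∈ ℒ(D)` then `(x) + D ≥ 0` has degree `0`, so `(x) + D = 0` and
`D = (x⁻¹)` is principal. [cite: Stichtenoth2009, Cor. 1.4.12(c)] -/
theorem ell_eq_zero_of_degree_eq_zero_of_not_isPrincipal {D : Divisor K F} (h0 : D.degree = 0)
    (hD : ¬ D.IsPrincipal) : ell D = 0 := by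
  by_contra hne
  have hpos : 0 < ell D := Nat.pos_of_ne_zero hne
  haveI := finiteDimensional_riemannRochSpace_of_isAlgFunctionField (K := K) D
  obtain ⟨y, hy⟩ := Module.finrank_pos_iff_exists_ne_zero.mp hpos
  have hy0 : (y : F) ≠ 0 := fun h => hy (Subtype.ext h)
  have hnonneg : 0 ≤ principalDivisor K (y : F) + D :=
    (mem_riemannRochSpace_iff_nonneg D hy0).mp y.2
  have hdeg : (principalDivisor K (y : F) + D).degree = 0 := by
    rw [map_add, degree_principalDivisor_eq_zero hy0, zero_add, h0]
  have hzero := Divisor.eq_zero_of_nonneg_of_degree_eq_zero hnonneg hdeg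
  exact hD ⟨(y : F)⁻¹, inv_ne_zero hy0,
    by rw [principalDivisor_inv hy0]; exact (eq_neg_of_add_eq_zero_right hzero).symm⟩

end DegreeZero

section ClassCount

variable [Fintype K] [IsAlgFunctionField K F] [IsIntegrallyClosedIn K F]

/-- **`A_n` class by class** (Stichtenoth Lemma 5.1.4 (b), summed over the divisor classes of
degree `n` as in the proof of Prop. 5.1.6 (b): `A_n = ∑_{deg [C] = n} |{A ∈ [C] ; A ≥ 0}|` and
`|{A ∈ [C] ; A ≥ 0}| (q - 1) = q^{ℓ([C])} - 1`):
`A_n · (q - 1) = ∑_{[C] ∈ Clⁿ(F)} (q^{ℓ([C])} - 1)`.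
[cite: Stichtenoth2009, Lemma 5.1.4(b) and Prop. 5.1.6(b) (proof)] -/
theorem numEffDivisors_mul_sub_one_eq_finsum (n : ℕ) :
    numEffDivisors K F n * (Fintype.card K - 1) =
      ∑ᶠ c : classesOfDegree (K := K) (F := F) n,
        (Fintype.card K ^ DivisorClass.ell (c : DivisorClass K F) - 1) := by
  set T := {D : Divisor K F // 0 ≤ D ∧ D.degree = n} with hT
  set Cl := classesOfDegree (K := K) (F := F) n with hCl
  haveI : Fintype T := Fintype.ofFinite T
  haveI : Fintype Cl := Fintype.ofFinite Cl
  -- the class map `T → Clⁿ` and its fibres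
  let π : T → Cl := fun D => ⟨DivisorClass.mk D.1, by
    rw [hCl, mem_classesOfDegree, DivisorClass.degree_mk, D.2.2]⟩
  have hfib : ∀ c : Cl, Fintype.card {D : T // π D = c} * (Fintype.card K - 1) =
      Fintype.card K ^ DivisorClass.ell (c : DivisorClass K F) - 1 := by
    intro c
    obtain ⟨c, hc⟩ := c
    induction c using QuotientAddGroup.induction_on with
    | H C =>
      rw [hCl, mem_classesOfDegree, DivisorClass.degree_mk] at hc
      change _ = Fintype.card K ^ DivisorClass.ell (DivisorClass.mk C) - 1
      rw [DivisorClass.ell_mk, ← Nat.card_eq_fintype_card (α := K),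
        ← natCard_nonneg_isLinearlyEquivalent_mul C, Fintype.card_eq_nat_card]
      congr 1
      refine Nat.card_congr ?_
      refine
        { toFun := fun D => ⟨D.1.1, D.1.2.1, DivisorClass.mk_eq_mk_iff.mp (congrArg Subtype.val D.2)⟩
          invFun := fun A => ⟨⟨A.1, A.2.1, ?_⟩, Subtype.ext (DivisorClass.mk_eq_mk_iff.mpr A.2.2)⟩
          left_inv := fun D => rfl
          right_inv := fun A => rfl }
      rw [Divisor.degree_eq_of_isLinearlyEquivalent A.2.2, hc]
  -- sum over the fibres
  have hsum : Fintype.card T = ∑ c : Cl, Fintype.card {D : T // π D = c} := by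
    rw [← Fintype.card_sigma]
    exact Fintype.card_congr (Equiv.sigmaFiberEquiv π).symm
  rw [numEffDivisors, ← hT, ← Fintype.card_eq_nat_card, hsum, Finset.sum_mul,
    Finset.sum_congr rfl fun c _ => hfib c, finsum_eq_sum_of_fintype]

/-- **The number `A_{2g-2}`** (`g ≥ 1`), where Lemma 5.1.4 (c) no longer applies: among the `h`
classes of degree `2g - 2` the canonical class has `ℓ = g` and every other class `[C]` has
`ℓ([C]) = g - 1` — Riemann–Roch gives `ℓ(C) = g - 1 + ℓ(W - C)` with `deg (W - C) = 0` and
`W - C` not principal (Stichtenoth, proof of Prop. 5.1.6 (b) / eq. (5.10), the term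
`deg [C] = 2g - 2` of `F(t)`). Hence `A_{2g-2} (q - 1) = (q^g - 1) + (h - 1)(q^{g-1} - 1)`, granted
`∂ = 1` (so that `|Cl^{2g-2}(F)| = h`). [cite: Stichtenoth2009, Prop. 5.1.6(b) (proof)] -/
theorem numEffDivisors_two_mul_genus_sub_two (h1 : minPosDegree K F = 1) (hg : 1 ≤ genus K F) :
    (numEffDivisors K F (2 * genus K F - 2) : ℤ) * ((Fintype.card K : ℤ) - 1) =
      ((Fintype.card K : ℤ) ^ genus K F - 1) +
        ((classNumber K F : ℤ) - 1) * ((Fintype.card K : ℤ) ^ (genus K F - 1) - 1) := by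
  set g : ℕ := genus K F with hgdef
  set q : ℕ := Fintype.card K with hqdef
  -- a canonical divisor
  obtain ⟨W, ⟨hWdeg, hWell⟩, hRR⟩ := riemann_roch_holds (K := K) (F := F)
  set Cl := classesOfDegree (K := K) (F := F) ((2 * g - 2 : ℕ) : ℤ) with hCl
  haveI : Fintype Cl := Fintype.ofFinite Cl
  have hWmem : DivisorClass.mk W ∈ Cl := by
    rw [hCl, mem_classesOfDegree, DivisorClass.degree_mk, hWdeg]
    push_cast [hgdef]
    omega
  set c₀ : Cl := ⟨DivisorClass.mk W, hWmem⟩ with hc₀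
  -- `ℓ` on the classes of degree `2g - 2`
  have hℓ₀ : DivisorClass.ell (c₀ : DivisorClass K F) = g := by
    simp [hc₀, DivisorClass.ell_mk, hWell, hgdef]
  have hℓ : ∀ c : Cl, c ≠ c₀ → DivisorClass.ell (c : DivisorClass K F) = g - 1 := by
    rintro ⟨c, hc⟩ hne
    induction c using QuotientAddGroup.induction_on with
    | H C =>
      rw [hCl, mem_classesOfDegree, DivisorClass.degree_mk] at hc
      have hCW : ¬ (W - C).IsPrincipal := by
        intro hp
        apply hne
        apply Subtype.ext
        change DivisorClass.mk C = DivisorClass.mk W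
        rw [DivisorClass.mk_eq_mk_iff]
        have : C - W = -(W - C) := by abel
        rw [Divisor.IsLinearlyEquivalent, this]
        exact hp.neg
      have hdeg0 : (W - C).degree = 0 := by rw [map_sub, hWdeg, hc]; omega
      have h0 := ell_eq_zero_of_degree_eq_zero_of_not_isPrincipal hdeg0 hCW
      have hC := hRR C
      rw [h0, hc, Nat.cast_zero, add_zero] at hC
      change ell C = g - 1
      omega
  -- count: `|Cl^{2g-2}| = h`
  have hcard : Fintype.card Cl = classNumber K F := by
    rw [Fintype.card_eq_nat_card, hCl]
    exact natCard_classesOfDegree_of_dvd (by rw [h1]; exact one_dvd _)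
  have hh : 1 ≤ classNumber K F := classNumber_pos
  -- the sum over classes, split at `c₀`
  have hsum := numEffDivisors_mul_sub_one_eq_finsum (K := K) (F := F) (2 * g - 2)
  rw [finsum_eq_sum_of_fintype, ← Finset.add_sum_erase _ _ (Finset.mem_univ c₀), hℓ₀] at hsum
  have hrest : ∑ c ∈ (Finset.univ : Finset Cl).erase c₀,
      (Fintype.card K ^ DivisorClass.ell (c : DivisorClass K F) - 1) =
        (classNumber K F - 1) * (q ^ (g - 1) - 1) := by
    rw [Finset.sum_congr rfl fun c hc => by rw [hℓ c (Finset.mem_erase.mp hc).1], Finset.sum_const,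
      Finset.card_erase_of_mem (Finset.mem_univ c₀), Finset.card_univ, hcard, smul_eq_mul]
  rw [hrest] at hsum
  -- cast to `ℤ`
  have hq1 : 1 ≤ q := Fintype.card_pos
  have hqg : 1 ≤ q ^ g := Nat.one_le_pow _ _ hq1
  have hqg1 : 1 ≤ q ^ (g - 1) := Nat.one_le_pow _ _ hq1
  have h := congrArg (fun x : ℕ => (x : ℤ)) hsum
  simp only [← hqdef] at h
  push_cast [Nat.cast_sub hq1, Nat.cast_sub hqg, Nat.cast_sub hqg1, Nat.cast_sub hh] at h
  linear_combination h

end ClassCount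


/-! ### The leading coefficient and Thm. 5.1.15 (a) -/

section Leading

variable [Fintype K] [IsAlgFunctionField K F] [IsIntegrallyClosedIn K F]

/-- **The leading coefficient `a_{2g} = q^g`** (Stichtenoth Thm. 5.1.15 (d)(1); the book derives it
from the functional equation, here it is computed directly), granted `∂ = 1`: for `g ≥ 1`,
`a_{2g} = A_{2g} - (q+1) A_{2g-1} + q A_{2g-2}` with `A_{2g}`, `A_{2g-1}` from Lemma 5.1.4 (c) and
`A_{2g-2}` from `numEffDivisors_two_mul_genus_sub_two`; for `g = 0`, `a₀ = A₀ = 1`.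
[cite: Stichtenoth2009, Thm. 5.1.15(d)(1)] -/
theorem coeff_two_mul_genus_lSeries (h1 : minPosDegree K F = 1) :
    coeff (2 * genus K F) (lSeries K F) = (Fintype.card K : ℤ) ^ genus K F := by
  rcases Nat.eq_zero_or_pos (genus K F) with hg | hg
  · rw [hg, mul_zero, pow_zero, coeff_zero_eq_constantCoeff_apply, constantCoeff_lSeries]
  · obtain ⟨k, hk⟩ : ∃ k, genus K F = k + 1 := ⟨genus K F - 1, by omega⟩
    have hq1 : (1 : ℤ) < Fintype.card K := by exact_mod_cast Fintype.one_lt_card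
    have hqne : (Fintype.card K : ℤ) - 1 ≠ 0 := by linarith
    have hA2 := numEffDivisors_mul_sub_one_eq (K := K) (F := F) h1 (n := 2 * k + 2) (by omega)
    have hA1 := numEffDivisors_mul_sub_one_eq (K := K) (F := F) h1 (n := 2 * k + 1) (by omega)
    have hA0 := numEffDivisors_two_mul_genus_sub_two (K := K) (F := F) h1 hg
    rw [hk] at hA0 hA1 hA2 ⊢
    rw [show 2 * k + 2 + 1 - (k + 1) = k + 2 by omega] at hA2
    rw [show 2 * k + 1 + 1 - (k + 1) = k + 1 by omega] at hA1
    rw [show 2 * (k + 1) - 2 = 2 * k by omega, Nat.add_sub_cancel] at hA0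
    rw [show 2 * (k + 1) = 2 * k + 2 by ring, coeff_add_two_lSeries]
    apply mul_left_cancel₀ hqne
    linear_combination hA2 - ((Fintype.card K : ℤ) + 1) * hA1 + (Fintype.card K : ℤ) * hA0

end Leading

/-- **Stichtenoth Thm. 5.1.15 (a) from F. K. Schmidt's theorem `∂ = 1`.** For an algebraic function
field `F/𝔽_q` of one variable with full constant field `𝔽_q` in which some divisor has degree `1`
(`minPosDegree K F = 1`, Cor. 5.1.11), the `L`-polynomial `L(t) = (1 - t)(1 - qt) Z(t)` is a
polynomial in `ℤ[t]` of degree `2g`, `g = genus 𝔽_q F` the Riemann–Roch genus: its coefficients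
vanish beyond `t^{2g}` (`coeff_lSeries_eq_zero`, from Lemma 5.1.4 (c), i.e. from the Riemann–Roch
theorem `riemann_roch_holds` and the finiteness of the class number, both proved in the tree) and
`a_{2g} = q^g ≠ 0` (`coeff_two_mul_genus_lSeries`). This discharges the named fact
`lSeries_eq_polynomial` of `FunctionFieldZeta` *conditionally on `∂ = 1`*; Schmidt's theorem itself
(Stichtenoth Prop. 5.1.10–Cor. 5.1.11, via the constant field extension of degree `∂`) is not in
the tree. [cite: Stichtenoth2009, Thm. 5.1.15(a)] [cite: Schmidt1931] -/
theorem lSeries_eq_polynomial_of_minPosDegree_eq_one [Fintype K] (h1 : minPosDegree K F = 1) :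
    lSeries_eq_polynomial K F := by
  intro _ _
  refine ⟨trunc (2 * genus K F + 1) (lSeries K F), ?_, ?_⟩
  · refine le_antisymm (Nat.lt_succ_iff.mp (natDegree_trunc_lt _ _)) ?_
    refine Polynomial.le_natDegree_of_ne_zero ?_
    rw [coeff_trunc, if_pos (Nat.lt_succ_self _), coeff_two_mul_genus_lSeries h1]
    exact pow_ne_zero _ (by exact_mod_cast Fintype.card_ne_zero)
  · ext m
    rw [Polynomial.coeff_coe, coeff_trunc]
    split_ifs with hm
    · rfl
    · exact (coeff_lSeries_eq_zero h1 (by omega)).symm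

end Literature.NumberTheory.DiophantineGeometry.AlgFunctionField

end
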